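import Summits.QuantumFields.BalabanUV.Beta.FP.NestedSliceDeadJets

/-!
# `BalabanUV.Beta.FP.NestedStepLawTransportedDeadRows` — road «FP» for binder row D1, ROUTE T, presentation T-β: **THE SIX DEAD-ROW LETTERS OF THE OWNER's
# `NestedStepLawTransported` §2 AT THE TORUS CALL's TYPES** (`p1 p2` one-shot chart, `s1 s2` nested fine chart, `t1 t2` nested coarse chart) **FROM «THE JET VANISHES
# ON THE COMB BONDS»** — first refusal leaf-06 (slices), OWNER d1-p3 g18 GO W-FP-18-3 (c) (journal l.40071; binder block quoted there)

WHAT.  The OWNER's S1 file `FP/NestedStepLawTransported` (INTENT I-FP-18-1, l.39996) kills the two surviving Faddeev–Popov 2-jets of the transported one-shot law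
under six DEAD-ROW letters, displayed at the torus instance (p316503's types VERBATIM, `W₀ := fromCols D₂ D₁`, `τ₁ τ₂ P` by `hτ₁ hτ₂ hP`) as
`p1 : P * W♯₁ = 0`, `p2 : P * W♯₂ = 0` (the one-shot big-comb slice reads bonds DEAD along the one-shot family's generator jets),
`s1 : τ₁ * W₁ = 0`, `s2 : τ₁ * W₂ = 0` (small-comb rows dead along the nested family), and
`t1 : τ₂ * (Q₁₁ * fromCols D₂ D₁ + Q₁₀ * W₁) = 0`, `t2 : τ₂ * (Q₁₂ * fromCols D₂ D₁ + 2•(Q₁₁ * W₁) + Q₁₀ * W₂) = 0` (coarse-comb rows of the AVERAGE dead).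
This module supplies each of the six from the natural comb-support hypothesis, BY NAME over my lineage's slice-kill lemmas:
* §1 `torus_p_of_vanish_on_bigComb` — at the call's `hP`: a jet `W♯` vanishing at every BIG-comb slot (`IsCombBondAt (Lc•toSite r′ + toSite r) (Lc·Lc)`) has `P * W♯ = 0`
  (`CombSliceRowJets.combSlice_mul_eq_zero_of_vanish_on_dead` at `e := resBigEquiv`); `…_of_eq_combBondT` (the `combBondT` wording).
* §2 `torus_s_of_vanish_on_smallComb` — at `hτ₁`: `W` vanishing at every SMALL-comb slot (`IsCombBondAt (toSite r) Lc` on the fine box) has `τ₁ * W = 0`;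
  `torus_coarse_of_vanish_on_coarseComb` — at `hτ₂`: `D̄` vanishing at every COARSE-comb slot (`IsCombBondAt (toSite r′) Lc` on `M′`) has `τ₂ * D̄ = 0`
  (`NestedSliceDeadJets.combSliceId_mul_eq_zero_of_vanish_on_combSlots`).
* §3 `t_of_covariance_letter` (generic: `J = fromCols D̄ 0` and `τ₂ * D̄ = 0` ⇒ `τ₂ * J = 0`), **`torus_t1_of_c1`**, **`torus_t2_of_c2`**: with leaf-02's MOVING covariance
  letters `c1 : Q₁₁ * fromCols D₂ D₁ + Q₁₀ * W₁ = fromCols D̄₁ 0`, `c2 : … = fromCols D̄₂ 0` (p314580 ∕ the Delta's displayed rows) the coarse letters `t1 t2` follow from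
  `D̄₁ D̄₂` vanishing at every coarse-comb slot.  (leaf-02 g18 supplies the further reduction «`τ₂ * D̄₁ = 0` ⟺ the direction's linear average vanishes on the coarse
  comb bonds», W-FP-18-4 (ii) — stated ONCE, there.)
NOT HERE: whether the literal's generator jets `W♯ₙ Wₙ D̄ₙ` DO vanish on the respective combs (the dictionary's reading of the insertion directions: an2 ∕ leaf-02 ∕
the OWNER), the transport letters, any estimate.

HONEST DEPENDENCY (page 1, mandatory): continuum YM on T⁴ ⇐ BetaPertH ∧ nine spine estimates (0/9 proved); BetaPertH ⇐ (D1) ∧ (D4) ∧ CAP+tail;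
G-an2-4 gates asym, D1 and NE2/3/4.  HONEST FRAMING (cell contract, verbatim): «discharging `BetaPertH` makes Bałaban's UV stability UNCONDITIONAL —
a real constructive-QFT result; it is NOT the continuum limit and NOT the Clay problem.»  ABSOLUTE RULE (cell charter, verbatim): «No internally-minted
statement may enter as a cited fact. Every hypothesis is either kernel-proved in this package or a verbatim quotation of a PUBLISHED theorem with page
reference. The manuscript(s) under audit are NOT citable for their own disputed steps — they are the thing under adjudication; programme-internal
(2001/route/tribunal) claims are never citable.»  [folklore] finite-matrix bookkeeping BY NAME over landed files; no `def`, no `def … : Prop`, nothing cited,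
0 sorry; 0 estimates; 0∕4 row-D1 binders; NOT the dictionary, NOT (T-ID), NOT SDF, NOT D1, NOT BetaPertH, NOT continuum, NOT Clay.  «not in print; our bookkeeping».
Provenance: D1 formalisation swarm LEAF PROVER 06, unit b2b-balaban-beta-d1-formalise-leaf-06 gen 18, 2026-08-22.  No existing file touched.
-/

noncomputable section

namespace Summit.QuantumFields.BalabanUV.Beta.FP.NestedStepLawTransportedDeadRows

open Matrix
open Literature.MathematicalPhysics.QuantumFieldTheory.Balaban1983to89
open Literature.MathematicalPhysics.QuantumFieldTheory.Balaban1983to89.Beta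
open B5Prop11Plancherel (fine)
open AffineAveraging (Site box toSite)
open B6Lemma24Torus (pbox)
open OneStepResolventKernel (Fib)
open Summit.QuantumFields.BalabanUV.Beta.AxialDressingRooted (IsCombBondAt)
open Summit.QuantumFields.BalabanUV.Beta.FP.KernelPeriodisationFib (Idx)
open Summit.QuantumFields.BalabanUV.Beta.FP.TorusCombRows (Res combBondT combRowsT)
open Summit.QuantumFields.BalabanUV.Beta.FP.TorusCombNestedBasis (resBigEquiv bigRoot_bounds fine_dvd)
open Summit.QuantumFields.BalabanUV.Beta.FP.CombSliceRowJets (combSlice_mul_eq_zero_of_vanish_on_dead isCombBondAt_of_combBondT_eq)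
open Summit.QuantumFields.BalabanUV.Beta.FP.NestedSliceDeadJets (combSliceId_mul_eq_zero_of_vanish_on_combSlots)
open Summit.QuantumFields.BalabanUV.Beta.GAN24.FineReadoutCauchyFrame (toSite_mem_range)

variable {d : ℕ}

/-! ## §1 The one-shot chart: `p1 p2` — the big-comb slice `P` of the torus call kills jets vanishing on the big-comb bonds -/

section OneShot

variable (M' : Fin (d + 1) → ℕ) {Lc : ℕ} [NeZero Lc] {r r' : Fin (d + 1) → ℕ}

/-- [folklore] **`P * W♯ = 0` FOR A JET DEAD ON THE BIG COMB** (`combBondT` wording): at the torus call's one-shot slice `P` (p313662 ∕ p316503 `hP` VERBATIM), a jet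
`W♯` whose rows vanish at every slot that is the comb bond of some big-comb residual parameter has `P * W♯ = 0`. -/
theorem torus_p_of_eq_combBondT (hr : r ∈ box (d + 1) Lc) (hr' : r' ∈ box (d + 1) Lc)
    {P : Matrix (Res (toSite r') Lc M' ⊕ Res (toSite r) Lc (fine Lc M')) (↥(pbox (fine Lc M')) × Fin (d + 1)) ℝ}
    (hP : P = (combRowsT ((Lc : ℤ) • toSite r' + toSite r) (Lc * Lc) (fine Lc M')).submatrix
        (resBigEquiv Lc Lc (toSite r) (toSite r') M' (Nat.pos_of_ne_zero (NeZero.ne Lc)) (toSite_mem_range hr)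
          (Nat.pos_of_ne_zero (NeZero.ne Lc)) (toSite_mem_range hr')).symm
        (fun b : ↥(pbox (fine Lc M')) × Fin (d + 1) => ((b.1, Sum.inl b.2) : Idx (fine Lc M') (Fib d))))
    {σ : Type*} (W : Matrix (↥(pbox (fine Lc M')) × Fin (d + 1)) σ ℝ)
    (hW : ∀ (b : ↥(pbox (fine Lc M')) × Fin (d + 1)) (x : Res ((Lc : ℤ) • toSite r' + toSite r) (Lc * Lc) (fine Lc M')),
      combBondT ((Lc : ℤ) • toSite r' + toSite r) (Lc * Lc) (fine Lc M') x = ((b.1, Sum.inl b.2) : Idx (fine Lc M') (Fib d)) → W b = 0) :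
    P * W = 0 := by
  subst hP
  exact combSlice_mul_eq_zero_of_vanish_on_dead _ W hW

/-- [folklore] **`p1`∕`p2` OF THE OWNER's `NestedStepLawTransported` §2 AT THE TORUS: `P * W♯ = 0` FOR A JET VANISHING AT EVERY BIG-COMB SLOT** (an2's wording
`IsCombBondAt (Lc•toSite r′ + toSite r) (Lc·Lc) α s`; requires `Lc ∣ M′ᵢ`). -/
theorem torus_p_of_vanish_on_bigComb (hr : r ∈ box (d + 1) Lc) (hr' : r' ∈ box (d + 1) Lc) (hM' : ∀ i, Lc ∣ M' i)
    {P : Matrix (Res (toSite r') Lc M' ⊕ Res (toSite r) Lc (fine Lc M')) (↥(pbox (fine Lc M')) × Fin (d + 1)) ℝ}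
    (hP : P = (combRowsT ((Lc : ℤ) • toSite r' + toSite r) (Lc * Lc) (fine Lc M')).submatrix
        (resBigEquiv Lc Lc (toSite r) (toSite r') M' (Nat.pos_of_ne_zero (NeZero.ne Lc)) (toSite_mem_range hr)
          (Nat.pos_of_ne_zero (NeZero.ne Lc)) (toSite_mem_range hr')).symm
        (fun b : ↥(pbox (fine Lc M')) × Fin (d + 1) => ((b.1, Sum.inl b.2) : Idx (fine Lc M') (Fib d))))
    {σ : Type*} (W : Matrix (↥(pbox (fine Lc M')) × Fin (d + 1)) σ ℝ)
    (hW : ∀ b : ↥(pbox (fine Lc M')) × Fin (d + 1), IsCombBondAt ((Lc : ℤ) • toSite r' + toSite r) (Lc * Lc) b.2 (b.1 : Site (d + 1)) → W b = 0) :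
    P * W = 0 := by
  have hLc : 0 < Lc := Nat.pos_of_ne_zero (NeZero.ne Lc)
  exact torus_p_of_eq_combBondT M' hr hr' hP W fun b _ h =>
    hW b (isCombBondAt_of_combBondT_eq (Nat.mul_pos hLc hLc) (bigRoot_bounds hLc (toSite_mem_range hr) (toSite_mem_range hr')) (fine_dvd hM') h)

end OneShot

/-! ## §2 The nested chart: `s1 s2` (small-comb rows on the fine box) and the coarse slice `τ₂` (coarse-comb rows on `M′`) -/

section Nested

variable (M' : Fin (d + 1) → ℕ) {Lc : ℕ} [NeZero Lc] {r r' : Fin (d + 1) → ℕ}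

/-- [folklore] **`s1`∕`s2` AT THE TORUS: `τ₁ * W = 0` FOR A JET VANISHING AT EVERY SMALL-COMB SLOT** (the call's `hτ₁` VERBATIM; `IsCombBondAt (toSite r) Lc` on the
fine box `fine Lc M′`). -/
theorem torus_s_of_vanish_on_smallComb (hr : r ∈ box (d + 1) Lc)
    {τ₁ : Matrix (Res (toSite r) Lc (fine Lc M')) (↥(pbox (fine Lc M')) × Fin (d + 1)) ℝ}
    (hτ₁ : τ₁ = (combRowsT (toSite r) Lc (fine Lc M')).submatrix id
        (fun b : ↥(pbox (fine Lc M')) × Fin (d + 1) => ((b.1, Sum.inl b.2) : Idx (fine Lc M') (Fib d))))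
    {σ : Type*} (W : Matrix (↥(pbox (fine Lc M')) × Fin (d + 1)) σ ℝ)
    (hW : ∀ b : ↥(pbox (fine Lc M')) × Fin (d + 1), IsCombBondAt (toSite r) Lc b.2 (b.1 : Site (d + 1)) → W b = 0) :
    τ₁ * W = 0 := by
  subst hτ₁
  exact combSliceId_mul_eq_zero_of_vanish_on_combSlots (Nat.pos_of_ne_zero (NeZero.ne Lc)) (toSite_mem_range hr) (fun i => ⟨M' i, rfl⟩) W hW

omit [NeZero Lc] in
/-- [folklore] **THE COARSE SLICE KILLS JETS DEAD ON THE COARSE COMB: `τ₂ * D̄ = 0`** (the call's `hτ₂` VERBATIM; `IsCombBondAt (toSite r′) Lc` on `M′`,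
`Lc ∣ M′ᵢ`, `0 < Lc`). -/
theorem torus_coarse_of_vanish_on_coarseComb (hLc : 0 < Lc) (hr' : r' ∈ box (d + 1) Lc) (hM' : ∀ i, Lc ∣ M' i)
    {τ₂ : Matrix (Res (toSite r') Lc M') (↥(pbox M') × Fin (d + 1)) ℝ}
    (hτ₂ : τ₂ = (combRowsT (toSite r') Lc M').submatrix id (fun b : ↥(pbox M') × Fin (d + 1) => ((b.1, Sum.inl b.2) : Idx M' (Fib d))))
    {σ : Type*} (Db : Matrix (↥(pbox M') × Fin (d + 1)) σ ℝ)
    (hDb : ∀ a : ↥(pbox M') × Fin (d + 1), IsCombBondAt (toSite r') Lc a.2 (a.1 : Site (d + 1)) → Db a = 0) :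
    τ₂ * Db = 0 := by
  subst hτ₂
  exact combSliceId_mul_eq_zero_of_vanish_on_combSlots hLc (toSite_mem_range hr') hM' Db hDb

end Nested

/-! ## §3 The nested coarse chart: `t1 t2` from leaf-02's moving covariance letters `c1 c2` and coarse jets dead on the coarse comb -/

section Coarse

/-- [folklore] generic: if a jet word `J` IS `fromCols D̄ 0` (a covariance letter) and the coarse slice kills `D̄`, then it kills `J`. -/
theorem t_of_covariance_letter {μ ρ₂ ρ₂' ρ₁' : Type*} [Fintype μ] (τ₂ : Matrix ρ₂ μ ℝ) (J : Matrix μ (ρ₂' ⊕ ρ₁') ℝ) (Db : Matrix μ ρ₂' ℝ)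
    (c : J = fromCols Db (0 : Matrix μ ρ₁' ℝ)) (h : τ₂ * Db = 0) : τ₂ * J = 0 := by
  rw [c, Matrix.mul_fromCols, h, Matrix.mul_zero, Matrix.fromCols_zero]

variable (M' : Fin (d + 1) → ℕ) {Lc : ℕ} [NeZero Lc] {r r' : Fin (d + 1) → ℕ}

/-- [folklore] **`t1` OF THE OWNER's `NestedStepLawTransported` §2 AT THE TORUS** (the call's `hτ₂` VERBATIM; ANY `Q₁₀ Q₁₁ D₂ D₁ W₁`): from leaf-02's moving
covariance letter `c1 : Q₁₁ * fromCols D₂ D₁ + Q₁₀ * W₁ = fromCols D̄₁ 0` and a coarse jet `D̄₁` vanishing at every coarse-comb slot,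
`τ₂ * (Q₁₁ * fromCols D₂ D₁ + Q₁₀ * W₁) = 0`. -/
theorem torus_t1_of_c1 (hr' : r' ∈ box (d + 1) Lc) (hM' : ∀ i, Lc ∣ M' i)
    {τ₂ : Matrix (Res (toSite r') Lc M') (↥(pbox M') × Fin (d + 1)) ℝ}
    (hτ₂ : τ₂ = (combRowsT (toSite r') Lc M').submatrix id (fun b : ↥(pbox M') × Fin (d + 1) => ((b.1, Sum.inl b.2) : Idx M' (Fib d))))
    (Q₁₀ Q₁₁ : Matrix (↥(pbox M') × Fin (d + 1)) (↥(pbox (fine Lc M')) × Fin (d + 1)) ℝ)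
    (D₂ : Matrix (↥(pbox (fine Lc M')) × Fin (d + 1)) (Res (toSite r') Lc M') ℝ)
    (D₁ : Matrix (↥(pbox (fine Lc M')) × Fin (d + 1)) (Res (toSite r) Lc (fine Lc M')) ℝ)
    (W₁ : Matrix (↥(pbox (fine Lc M')) × Fin (d + 1)) (Res (toSite r') Lc M' ⊕ Res (toSite r) Lc (fine Lc M')) ℝ)
    (Db₁ : Matrix (↥(pbox M') × Fin (d + 1)) (Res (toSite r') Lc M') ℝ)
    (c1 : Q₁₁ * fromCols D₂ D₁ + Q₁₀ * W₁ = fromCols Db₁ 0)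
    (hDb₁ : ∀ a : ↥(pbox M') × Fin (d + 1), IsCombBondAt (toSite r') Lc a.2 (a.1 : Site (d + 1)) → Db₁ a = 0) :
    τ₂ * (Q₁₁ * fromCols D₂ D₁ + Q₁₀ * W₁) = 0 :=
  t_of_covariance_letter τ₂ _ Db₁ c1
    (torus_coarse_of_vanish_on_coarseComb M' (Nat.pos_of_ne_zero (NeZero.ne Lc)) hr' hM' hτ₂ Db₁ hDb₁)

/-- [folklore] **`t2` AT THE TORUS**: from `c2 : Q₁₂ * fromCols D₂ D₁ + 2•(Q₁₁ * W₁) + Q₁₀ * W₂ = fromCols D̄₂ 0` and `D̄₂` vanishing at every coarse-comb slot,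
`τ₂ * (Q₁₂ * fromCols D₂ D₁ + 2•(Q₁₁ * W₁) + Q₁₀ * W₂) = 0`. -/
theorem torus_t2_of_c2 (hr' : r' ∈ box (d + 1) Lc) (hM' : ∀ i, Lc ∣ M' i)
    {τ₂ : Matrix (Res (toSite r') Lc M') (↥(pbox M') × Fin (d + 1)) ℝ}
    (hτ₂ : τ₂ = (combRowsT (toSite r') Lc M').submatrix id (fun b : ↥(pbox M') × Fin (d + 1) => ((b.1, Sum.inl b.2) : Idx M' (Fib d))))
    (Q₁₀ Q₁₁ Q₁₂ : Matrix (↥(pbox M') × Fin (d + 1)) (↥(pbox (fine Lc M')) × Fin (d + 1)) ℝ)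
    (D₂ : Matrix (↥(pbox (fine Lc M')) × Fin (d + 1)) (Res (toSite r') Lc M') ℝ)
    (D₁ : Matrix (↥(pbox (fine Lc M')) × Fin (d + 1)) (Res (toSite r) Lc (fine Lc M')) ℝ)
    (W₁ W₂ : Matrix (↥(pbox (fine Lc M')) × Fin (d + 1)) (Res (toSite r') Lc M' ⊕ Res (toSite r) Lc (fine Lc M')) ℝ)
    (Db₂ : Matrix (↥(pbox M') × Fin (d + 1)) (Res (toSite r') Lc M') ℝ)
    (c2 : Q₁₂ * fromCols D₂ D₁ + (2 : ℝ) • (Q₁₁ * W₁) + Q₁₀ * W₂ = fromCols Db₂ 0)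
    (hDb₂ : ∀ a : ↥(pbox M') × Fin (d + 1), IsCombBondAt (toSite r') Lc a.2 (a.1 : Site (d + 1)) → Db₂ a = 0) :
    τ₂ * (Q₁₂ * fromCols D₂ D₁ + (2 : ℝ) • (Q₁₁ * W₁) + Q₁₀ * W₂) = 0 :=
  t_of_covariance_letter τ₂ _ Db₂ c2
    (torus_coarse_of_vanish_on_coarseComb M' (Nat.pos_of_ne_zero (NeZero.ne Lc)) hr' hM' hτ₂ Db₂ hDb₂)

end Coarse

end Summit.QuantumFields.BalabanUV.Beta.FP.NestedStepLawTransportedDeadRows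

end
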